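import Mathlib
import HarnessLib
import Literature.Analysis.FluidPDE.SelfSimilar
import Literature.Analysis.FluidPDE.LocalTypeI
import Literature.Analysis.FluidPDE.VectorCalculus
import Literature.Analysis.FluidPDE.VorticityCalculus
import Literature.Analysis.FluidPDE.TaoEnstrophyLocalisation
import Literature.Analysis.FluidPDE.CurlFreeLiouville
import Literature.Analysis.FluidPDE.TypeIAncientMild
import Literature.Analysis.UnboundedOperators.HeatKernel
import Summits.NavierStokesRegularity.NavierStokesRegularity.Theorems.LocalSineTubeDoorProfileAlignedWindowRigidityAncient
import Summits.NavierStokesRegularity.NavierStokesRegularity.Theorems.PoloidalWindowDoorPoloidalWindowRigidityWindow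
import Summits.NavierStokesRegularity.NavierStokesRegularity.Theorems.PoloidalWindowDoorPoloidalWindowRigidityFlat

/-!
# Route `PoloidalWindowDoor`, crux `PoloidalWindowRigidity` (K2, stmt-NavierStokesRegularity-19708) — the stratum
# «time-periodic (in particular steady) VORTICITY» is empty

Cell ns-regularity-ideate, seat ns-poloidal-K2-p3 (stub-worker; support theorem `--supports` the crux, `--as helper`).
nsreg-p6's `…Strata.eq_zero_of_timePeriodic` / `eq_zero_of_steady` settle the stratum of profiles whose VELOCITY is
time-periodic (the Type-I rate alone kills them).  Here only the VORTICITY is assumed time-periodic,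
`curl v(s − P) = curl v(s)` for all `s < 0` (some period `P > 0`); a priori the velocity could drift by a time-dependent
constant.  Still `v ≡ 0`, and NO poloidality is needed:

* `sub_slice_eq_sub_slice_of_curl_eq` — if two slices of bounded incompressible `C²` fields have the same curl, they
  differ by a constant: `V y − V z = V' y − V' z` (tree div–curl Liouville `eq_of_curl_eq_zero_of_isDivFree_of_bounded`
  on `V − V'`);
* `eq_zero_of_curl_timePeriodic` — hence `v(s)(y) − v(s)(z) = v(s − nP)(y) − v(s − nP)(z)` for every `n`, and the
  right side is `≤ 2C/√(nP − s) → 0` by the Type-I rate: every slice is spatially constant, and the Oseen gauge kills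
  slice-constant profiles (tree `IsTypeIAncientMild.eq_zero_of_slice_const`, KNSS 2009 Remark 6.1);
* `eq_zero_of_curl_steady` — steady vorticity (`curl v(s) = curl v(t)` for all `s, t < 0`) is the case `P = 1`.

WHAT THIS IS NOT: not a claim about Navier–Stokes regularity and not the open residue — one more settled stratum
(vorticity-level time symmetry) of a door route's Type-I Liouville problem (bears_on LADDER-NS N0, rung
N0-LocalTubeDoorPoloidal).
-/

noncomputable section

-- the summit and its single sub-problem share the name (CONVENTIONS §1), as in every Theorems file
set_option linter.dupNamespace false

namespace Summit.NavierStokesRegularity.NavierStokesRegularity.Theorems.PoloidalWindowDoorPoloidalWindowRigidityVorticityTimePeriodic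

open MeasureTheory Set Function Filter Topology TopologicalSpace Metric InnerProductSpace
open scoped RealInnerProductSpace InnerProductSpace
open Literature.Analysis Literature.Analysis.FluidPDE
open Summit.NavierStokesRegularity.NavierStokesRegularity.Theorems.LocalSineTubeDoorProfileAlignedWindowRigidityAncient
open Summit.NavierStokesRegularity.NavierStokesRegularity.Theorems.PoloidalWindowDoorPoloidalWindowRigidityWindow
open Summit.NavierStokesRegularity.NavierStokesRegularity.Theorems.PoloidalWindowDoorPoloidalWindowRigidityFlat

/-- **Two bounded incompressible `C²` fields with the same curl differ by a constant**:
`V y − V z = V' y − V' z` (div–curl Liouville applied to `V − V'`). -/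
theorem sub_slice_eq_sub_slice_of_curl_eq {V V' : EuclideanSpace ℝ (Fin 3) → EuclideanSpace ℝ (Fin 3)}
    (hV : ContDiff ℝ 2 V) (hV' : ContDiff ℝ 2 V') (hdiv : VectorCalculus.IsDivFree V)
    (hdiv' : VectorCalculus.IsDivFree V') {M M' : ℝ} (hM : ∀ x, ‖V x‖ ≤ M) (hM' : ∀ x, ‖V' x‖ ≤ M')
    (hcurl : ∀ x, curl V x = curl V' x) (y z : EuclideanSpace ℝ (Fin 3)) : V y - V z = V' y - V' z := by
  set W : EuclideanSpace ℝ (Fin 3) → EuclideanSpace ℝ (Fin 3) := fun x => V x - V' x with hW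
  have hW2 : ContDiff ℝ 2 W := hV.sub hV'
  have hVd : ∀ x, DifferentiableAt ℝ V x := fun x => (hV.differentiable two_ne_zero) x
  have hVd' : ∀ x, DifferentiableAt ℝ V' x := fun x => (hV'.differentiable two_ne_zero) x
  have hcurlW : ∀ x, curl W x = 0 := fun x => by
    rw [hW, curl_sub (hVd x) (hVd' x), hcurl x, sub_self]
  have hdivW : VectorCalculus.IsDivFree W := fun x => by
    have h1 := hdiv x
    have h2 := hdiv' x
    unfold VectorCalculus.divergence at h1 h2 ⊢
    rw [hW, fderiv_fun_sub (hVd x) (hVd' x), ContinuousLinearMap.toLinearMap_sub, map_sub, h1, h2, sub_self]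
  have hWbd : ∀ x, ‖W x‖ ≤ M + M' := fun x => (norm_sub_le _ _).trans (add_le_add (hM x) (hM' x))
  have h := eq_of_curl_eq_zero_of_isDivFree_of_bounded hW2 hcurlW hdivW hWbd y z
  simp only [hW] at h
  -- `V y - V' y = V z - V' z`
  exact sub_eq_sub_iff_sub_eq_sub.mp h

variable {C : ℝ} {v : ℝ → EuclideanSpace ℝ (Fin 3) → EuclideanSpace ℝ (Fin 3)}

/-- **Time-periodic VORTICITY ⇒ trivial.**  A profile of the route's Type-I class (rate, continuity on the open slab,
unit-viscosity Oseen-mild identity, divergence-free slices) whose vorticity is time-periodic with some period `P > 0`,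
`curl v(s − P) = curl v(s)` for all `s < 0`, vanishes identically: `v(s)(y) − v(s)(z) = v(s − nP)(y) − v(s − nP)(z)`
(`sub_slice_eq_sub_slice_of_curl_eq`, induction on `n`) is bounded by `2C/√(nP − s) → 0`, so every slice is
spatially constant, and the Oseen gauge excludes slice-constant profiles (KNSS 2009, Remark 6.1).  No poloidality. -/
theorem eq_zero_of_curl_timePeriodic (hrate : HasTypeITimeDecay C v)
    (hcont : ContinuousOn (uncurry v) (Iio (0 : ℝ) ×ˢ univ))
    (hmild : ∀ s t : ℝ, s < t → t < 0 → ∀ x,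
      v t x = UnboundedOperators.heatExtension (v s) (t - s) x - oseenDuhamel 1 s v v t x)
    (hdiv : ∀ t < 0, VectorCalculus.IsDivFree (v t)) {P : ℝ} (hP : 0 < P)
    (hper : ∀ s < 0, ∀ y, curl (v (s - P)) y = curl (v s) y) : ∀ t < 0, ∀ x, v t x = 0 := by
  have hbdd := bdd_of_hasTypeITimeDecay hrate
  have hA : IsTypeIAncientMild C v := isTypeIAncientMild_of_class hrate hcont hmild hdiv
  have hC0 : 0 ≤ C := hA.nonneg
  -- one period back: the slice changes by a constant
  have hstep : ∀ s < 0, ∀ y z, v s y - v s z = v (s - P) y - v (s - P) z := by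
    intro s hs y z
    have hsP : s - P < 0 := by linarith
    exact sub_slice_eq_sub_slice_of_curl_eq (analyticOnNhd_slice hcont hbdd hmild hs).contDiff
      (analyticOnNhd_slice hcont hbdd hmild hsP).contDiff (hdiv s hs) (hdiv (s - P) hsP)
      (fun x => hrate s hs x) (fun x => hrate (s - P) hsP x) (fun x => (hper s hs x).symm) y z
  -- `n` periods back
  have hiter : ∀ (n : ℕ), ∀ s < 0, ∀ y z, v s y - v s z = v (s - n * P) y - v (s - n * P) z := by
    intro n
    induction n with
    | zero => intro s hs y z; simp
    | succ n ih =>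
      intro s hs y z
      have hsn : s - n * P < 0 := by
        have : (0 : ℝ) ≤ n * P := mul_nonneg (Nat.cast_nonneg n) hP.le
        linarith
      rw [ih s hs y z, hstep (s - n * P) hsn y z]
      push_cast
      ring_nf
  -- the slices are spatially constant
  have hconst : ∀ s < 0, ∀ y, v s y = v s 0 := by
    intro s hs y
    have hbound : ∀ n : ℕ, ‖v s y - v s 0‖ ≤ 2 * C / Real.sqrt (n * P - s) := fun n => by
      have hsn : s - n * P < 0 := by
        have : (0 : ℝ) ≤ n * P := mul_nonneg (Nat.cast_nonneg n) hP.le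
        linarith
      rw [hiter n s hs y 0]
      have h1 := hrate (s - n * P) hsn y
      have h2 := hrate (s - n * P) hsn 0
      rw [show -(s - n * P) = n * P - s by ring] at h1 h2
      calc ‖v (s - n * P) y - v (s - n * P) 0‖ ≤ ‖v (s - n * P) y‖ + ‖v (s - n * P) 0‖ := norm_sub_le _ _
        _ ≤ C / Real.sqrt (n * P - s) + C / Real.sqrt (n * P - s) := add_le_add h1 h2
        _ = 2 * C / Real.sqrt (n * P - s) := by ring
    have hlim : Tendsto (fun n : ℕ => 2 * C / Real.sqrt (n * P - s)) atTop (𝓝 0) := by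
      have h1 : Tendsto (fun n : ℕ => (n : ℝ) * P - s) atTop atTop :=
        tendsto_atTop_add_const_right _ (-s) (tendsto_natCast_atTop_atTop.atTop_mul_const hP)
      exact tendsto_const_nhds.div_atTop (Real.tendsto_sqrt_atTop.comp h1)
    have h0 : ‖v s y - v s 0‖ ≤ 0 := le_of_tendsto_of_tendsto' tendsto_const_nhds hlim hbound
    exact sub_eq_zero.1 (norm_le_zero_iff.1 h0)
  exact fun t ht x => hA.eq_zero_of_slice_const (b := fun t => v t 0) hconst ht x

/-- **Time-periodic vorticity ⇒ not backward-singular.** -/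
theorem nonflatLiouville_of_curl_timePeriodic (hrate : HasTypeITimeDecay C v)
    (hcont : ContinuousOn (uncurry v) (Iio (0 : ℝ) ×ˢ univ))
    (hmild : ∀ s t : ℝ, s < t → t < 0 → ∀ x,
      v t x = UnboundedOperators.heatExtension (v s) (t - s) x - oseenDuhamel 1 s v v t x)
    (hdiv : ∀ t < 0, VectorCalculus.IsDivFree (v t)) {P : ℝ} (hP : 0 < P)
    (hper : ∀ s < 0, ∀ y, curl (v (s - P)) y = curl (v s) y) : ¬ IsBackwardSingularPoint v 0 :=
  not_backwardSingular_of_zero (eq_zero_of_curl_timePeriodic hrate hcont hmild hdiv hP hper)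

/-- **Steady VORTICITY ⇒ trivial**: if all vorticity slices coincide (`curl v(s) = curl v(t)` for all `s, t < 0`),
the profile vanishes (the case `P = 1` of `eq_zero_of_curl_timePeriodic`). -/
theorem eq_zero_of_curl_steady (hrate : HasTypeITimeDecay C v)
    (hcont : ContinuousOn (uncurry v) (Iio (0 : ℝ) ×ˢ univ))
    (hmild : ∀ s t : ℝ, s < t → t < 0 → ∀ x,
      v t x = UnboundedOperators.heatExtension (v s) (t - s) x - oseenDuhamel 1 s v v t x)
    (hdiv : ∀ t < 0, VectorCalculus.IsDivFree (v t))
    (hst : ∀ s t : ℝ, s < 0 → t < 0 → ∀ y, curl (v s) y = curl (v t) y) : ∀ t < 0, ∀ x, v t x = 0 :=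
  eq_zero_of_curl_timePeriodic hrate hcont hmild hdiv one_pos
    fun s hs y => hst (s - 1) s (by linarith) hs y

/-- **Steady vorticity ⇒ not backward-singular.** -/
theorem nonflatLiouville_of_curl_steady (hrate : HasTypeITimeDecay C v)
    (hcont : ContinuousOn (uncurry v) (Iio (0 : ℝ) ×ˢ univ))
    (hmild : ∀ s t : ℝ, s < t → t < 0 → ∀ x,
      v t x = UnboundedOperators.heatExtension (v s) (t - s) x - oseenDuhamel 1 s v v t x)
    (hdiv : ∀ t < 0, VectorCalculus.IsDivFree (v t))
    (hst : ∀ s t : ℝ, s < 0 → t < 0 → ∀ y, curl (v s) y = curl (v t) y) : ¬ IsBackwardSingularPoint v 0 :=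
  not_backwardSingular_of_zero (eq_zero_of_curl_steady hrate hcont hmild hdiv hst)

end Summit.NavierStokesRegularity.NavierStokesRegularity.Theorems.PoloidalWindowDoorPoloidalWindowRigidityVorticityTimePeriodic

end
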